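import Summits.CriticalPhenomena.SAWScalingLimit.Theses.SAWTwistedSelfEnergy
import HarnessLib

/-!
# Survival form of the dead-end restriction atom (line `Sketch` = R2K4, crux stmt-CriticalPhenomena-1881) — STATEMENT ONLY

Lead a1, 2026-08-17.  This file TYPES (it proves nothing about) the only repair of the refuted atom
`UniformDeadEndRestriction` (`Lines/SketchR2K4_1881_udr_false.lean`) for which no lattice counterexample was found:
`UDRHoleFree` — the uniform dead-end restriction lower bound restricted to

* HOLE-FREE vertex sets `Λ` (complement king-connected to infinity: `HoleFree8`) — the conditional future domains
  `Ω_δ ∖ γ[0,t)` of the `x_c`-SAW are of this kind exactly when the lattice start `a_δ` is 8-adjacent to `ℤ² ∖ Ω_δ`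
  (a FLOATING start makes the past a slit not attached to the boundary, and then the theta gadget of
  `Lines/SketchR2K4_1881-dead.md` §3 (R4) refutes every past-uniform dead-end atom);
* CONNECTED mouths `K` (induced subgraph), as the lattice circle arcs of the Kemppainen–Smirnov components are;
* pockets defined by COMPONENTS: `pocketC Λ K c b` = the vertices of `Λ ∖ K` joined (inside `Λ ∖ K`) neither to `c`
  nor to `b` — the typed `pocket` of the sketch used `CutFrom`, which degenerates for two-piece mouths.

Status (dead file §4): OPEN; implies a finiteness/decay statement for the critical two-point function of the type of
stmt-CriticalPhenomena-7117 (the card's fat-chamber argument is hole-free); consumable by a Kemppainen–Smirnov index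
port ONLY for boundary-adjacent endpoint approximations, a strict sub-case of the crux as typed.
-/

noncomputable section

open MeasureTheory Filter Topology Set Metric
open scoped ENNReal NNReal
open Literature.Probability.RandomPlanarGeometry Literature.Probability.LatticeModels

namespace Summit.CriticalPhenomena.SAWScalingLimit.Cruxes.EventualTight.LineSketchR2K4.Survival

/-- Self-avoiding lattice paths `c → b` of `ℤ²` with all vertices in `Λ` (as in the sketch). -/
def LatPath (Λ : Set (Site 2)) (c b : Site 2) : Type :=
  {p : (zdGraph 2).Walk c b // p.IsPath ∧ ∀ v ∈ p.support, v ∈ Λ}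

/-- `x_c`-mass `Z_Λ(c,b)` (as in the sketch). -/
def mass (Λ : Set (Site 2)) (c b : Site 2) : ENNReal :=
  ∑' p : LatPath Λ c b, ENNReal.ofReal (SAW.criticalFugacity ^ p.1.length)

/-- `x` and `y` are joined by a lattice walk all of whose vertices lie in `S`. -/
def JoinedIn (S : Set (Site 2)) (x y : Site 2) : Prop :=
  ∃ p : (zdGraph 2).Walk x y, ∀ w ∈ p.support, w ∈ S

/-- King (8-neighbour) adjacency on `ℤ²`: distinct sites at sup-distance `1`. -/
def KingAdj (u v : Site 2) : Prop :=
  u ≠ v ∧ |u 0 - v 0| ≤ 1 ∧ |u 1 - v 1| ≤ 1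

/-- **Hole-free (8-version)**: every site off `Λ` is joined to sites of arbitrarily large ordinate by a chain of
king-adjacent sites off `Λ` (for finite `Λ`: `ℤ² ∖ Λ` is king-connected, i.e. `Λ` has no enclosed complementary
pocket; simple closed 4-curves separate king-connectivity, Rosenfeld).  Lattice slit domains `Ω_δ ∖ past` with the
start of the past 8-adjacent to `ℤ² ∖ Ω_δ` are hole-free in this sense. -/
def HoleFree8 (Λ : Set (Site 2)) : Prop :=
  ∀ g ∉ Λ, ∀ M : ℤ, ∃ g', M ≤ g' 1 ∧ Relation.ReflTransGen (fun u v => KingAdj u v ∧ u ∉ Λ ∧ v ∉ Λ) g g'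

/-- `K` is connected as an induced subgraph of `ℤ²` (nonempty, any two sites joined inside `K`). -/
def ConnectedSet (K : Set (Site 2)) : Prop :=
  K.Nonempty ∧ ∀ x ∈ K, ∀ y ∈ K, JoinedIn K x y

/-- **Component pocket**: the vertices of `Λ ∖ K` joined inside `Λ ∖ K` neither to `c` nor to `b` — the union of
the connected components of `Λ ∖ K` containing neither endpoint (genuine culs-de-sac behind the mouth `K` when `Λ`
is hole-free and `K` is connected). -/
def pocketC (Λ K : Set (Site 2)) (c b : Site 2) : Set (Site 2) :=
  {v | v ∈ Λ ∧ v ∉ K ∧ ¬ JoinedIn (Λ \ K) v c ∧ ¬ JoinedIn (Λ \ K) v b}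

/-- **`UDRHoleFree C q n₁` — the survival form of the atom.**  For every FINITE HOLE-FREE `Λ`, endpoints `c b ∈ Λ`
joined off the pocket, CONNECTED mouth `K ⊆ Λ`, centre `z₀`, radius `r ≥ n₁`:
* (outward) if `K ⊆ B̄(z₀, r)`, deleting the part of `pocketC Λ K c b` beyond radius `C r` keeps the fraction
  `1 - q` of `Z_Λ(c,b)`;
* (inward) if `K ∩ B(z₀, C r) = ∅`, deleting the part of `pocketC Λ K c b` inside `B̄(z₀, r)` keeps the fraction
  `1 - q`. -/
def UDRHoleFree (C q : ℝ) (n₁ : ℕ) : Prop :=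
  ∀ (Λ K : Set (Site 2)) (c b : Site 2) (z₀ : ℂ) (r : ℝ), Λ.Finite → HoleFree8 Λ → K ⊆ Λ → ConnectedSet K →
    c ∈ Λ → b ∈ Λ → JoinedIn (Λ \ pocketC Λ K c b) c b → (n₁ : ℝ) ≤ r →
    ((∀ v ∈ K, dist (Site.toComplex v) z₀ ≤ r) →
      ENNReal.ofReal (1 - q) * mass Λ c b ≤
        mass (Λ \ {v | v ∈ pocketC Λ K c b ∧ C * r ≤ dist (Site.toComplex v) z₀}) c b) ∧
    ((∀ v ∈ K, C * r ≤ dist (Site.toComplex v) z₀) →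
      ENNReal.ofReal (1 - q) * mass Λ c b ≤
        mass (Λ \ {v | v ∈ pocketC Λ K c b ∧ dist (Site.toComplex v) z₀ ≤ r}) c b)

/-- The survival atom, existentially packaged. OPEN (≥ stmt-CriticalPhenomena-7117-type two-point finiteness). -/
def UniformDeadEndRestrictionHoleFree : Prop :=
  ∃ C q : ℝ, ∃ n₁ : ℕ, 1 < C ∧ q < 1 ∧ UDRHoleFree C q n₁

/-- Sanity: the survival atom is monotone in `q` (any `q < 1` will do once one does, by the KS modulus-splitting
iteration — not formalised here). [folklore] -/
theorem udrHoleFree_mono {C q q' : ℝ} {n₁ : ℕ} (hq : q ≤ q') (h : UDRHoleFree C q n₁) : UDRHoleFree C q' n₁ := by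
  intro Λ K c b z₀ r hΛ hH hK hKc hc hb hj hr
  obtain ⟨h1, h2⟩ := h Λ K c b z₀ r hΛ hH hK hKc hc hb hj hr
  have hle : ENNReal.ofReal (1 - q') ≤ ENNReal.ofReal (1 - q) := ENNReal.ofReal_le_ofReal (by linarith)
  exact ⟨fun hKr => le_trans (mul_le_mul_left hle _) (h1 hKr),
    fun hKr => le_trans (mul_le_mul_left hle _) (h2 hKr)⟩

end Summit.CriticalPhenomena.SAWScalingLimit.Cruxes.EventualTight.LineSketchR2K4.Survival

end
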